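import Summits.CriticalPhenomena.PercolationContinuityZ3.Theorems.PercNearOneGluingNoHeavyQuantGateMoveBlob
import Summits.CriticalPhenomena.PercolationContinuityZ3.Theorems.PercNearOneGluingNoHeavyQuantSingleLowCapacity
import Summits.CriticalPhenomena.PercolationContinuityZ3.Theorems.PercNearOneGluingNoHeavyQuantFlowUncross
import HarnessLib

/-!
# QUANT lane R8, T-DEC, leg (III): THE MOVE LEMMA (M) IS FALSE FOR A GENERAL BLOB SIZE WITHOUT THE SUPPORT HYPOTHESIS —
# `gateMoveBlob_general_witness`: an explicit law for which `slice ν a g` is DEC (indeed at every layer) and the moved slice is not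

builds on p205010 (kernel theorem, internal audit signed; external expert review pending)

Witness + support file (`--supports stmt-CriticalPhenomena-4575`), QUANT lane lead seat prim-quant-lead (gen 30), rung R8 of
`run/shared/lean/prim/quant/LADDER.md`.  Theorems only, standard axioms, no sorries.  Lane README V318 (lead g30).

WHAT IS REFUTED.  Typer g27's move lemma `LawDec.decAtT_gateMoveBlob` (`…QuantGateMoveBlob`, p332881) carries the support hypothesis
`hsupp : ∀ k, 0 < k → k < a → (1 − g)·ν k = 0` (no unshifted atom strictly between `0` and `a`); the lane's programme for the blob case of
leg (III) since README V300 was the same statement WITHOUT `hsupp` ("(M) for general `a`"; arm-1 g39's `TwinMoveDEC` route —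
`decAtT_gateMoveBlob_of_twinMove` —, typer g28's corner-datum route — `flowAtT_gateMoveBlob_of_corner_income` —, lead g29's `MixedShiftDEC`).
That statement is FALSE: this file exhibits `ν = {0: 2/9, 1: 17/27, 20: 4/27}` (`M = 20`, mean `S = 97/27`), blob `a = 2`, `g = 1/4`,
`z = 7/45 ≤ ν 0`, floor `y = 97/540 = S/M` (top-affordability tight, threshold `y ≤ (1−z)g = 19/90` slack), layer `j = 8`, for which EVERY
hypothesis of `decAtT_gateMoveBlob` except `hsupp` holds — in particular `Λ = slice ν 2 (1/4) = {0: 1/6, 1: 17/36, 2: 1/18, 3: 17/108, 20: 1/9, 22: 1/27}`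
IS `DECAtT y (S + ag) 8 22` (flow `0 → 22`, `1 → 20`, `2 → 3`; the exact engine finds `Λ` DEC at every layer `0..22`) — while the conclusion
fails: `P = Λ + gz(δ₀ − δ₂) = {0: 37/180, 1: 17/36, 2: 1/60, 3: 17/108, 20: 1/9, 22: 1/27}` is NOT `DECAtT y (S + ag − zag) 8 22`: at the target
`t = 542/135` the lows `0` and `1` are compatible with no mid (`0 + 3, 1 + 3 ≤ 4 < t`) and the giants `{20, 22}` (mass `4/27`) can carry at most
`(4/27)(1−y)/y = 1772/2619 < 122/180 = P 0 + P 1` of low mass (weak duality with the prices `α₀ = α₁ = 1`, `β_h = 443/97` for `h ≥ 4`).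
MECHANISM: the blob atom `a = 2` is a cheap `t`-low of `Λ` (a light pair into the mid `3`); the move puts `gz = 7/180` of it on the zero atom,
which only the nearly saturated giants can absorb; the target drop `zag = 7/90` buys nothing on giants.  The witness was found by the lead's
exact engine on the light-far-top / top-affordability-tight corner (1 / 4 500) that the lane's generic censuses do not populate.
CONSEQUENCES (README V313/V317/V318): every one-layer / single-datum form of the blob step is refuted (`MixedShiftDEC`: `not_mixedShiftDEC`;
`TwinMoveDEC`: prim-quant-arm-3 g62's witness; (M) for general `a`: this file); the statement of record for the blob case of leg (III) is the
WINDOW form (ν DEC at every layer of `[j − a, j]`; prim-quant-arm-3 g60/g61 0 / 5 780 088, lead g30 kit 0 / 600 000) — in the witness `ν` is not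
DEC at the layers `1..19`.  `GateMove`, `GatedConvEmptyFree`, `SingleGateConvClosed` (all-layer hypotheses) are untouched and OPEN.

* `LawDec.gmwSlice_eq` — the closed form of `slice ν 2 (1/4)` for the witness law (local notation `gmwLaw`).
* `LawDec.gmw_hypLam` — `Λ` is `DECAtT (97/540) (97/27 + 2·(1/4)) 8 (20 + 2)` (explicit three-route flow).
* `LawDec.gmw_not_conclusion` — the moved slice is not `DECAtT (97/540) (97/27 + 2·(1/4) − (7/45)·2·(1/4)) 8 (20 + 2)`.
* **`LawDec.gateMoveBlob_general_witness`** — the existential refutation, binder = `decAtT_gateMoveBlob` minus `hsupp`.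

[this work]; (M): prim-quant-stmt g27 (this lane).  Nothing here is cited as a published result.  The gluing rows served
[cite: KozmaNitzan2024, Conjecture 3 (p. 15)]; product measure [cite: Grimmett1999, §1.3 p. 10].
-/

noncomputable section

namespace Summit.CriticalPhenomena.PercolationContinuityZ3.Theorems

namespace Quant

open Finset

/-- the witness law `ν = {0: 2/9, 1: 17/27, 20: 4/27}` (lead g30), as a local notation -/
local notation3 "gmwLaw" =>
  (fun h : ℕ => if h = 0 then (2 : ℝ) / 9 else if h = 1 then 17 / 27 else if h = 20 then 4 / 27 else 0)

/-- its slice by the blob `{0, 2; 1/4}`, in closed form -/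
local notation3 "gmwLam" =>
  (fun h : ℕ => if h = 0 then (1 : ℝ) / 6 else if h = 1 then 17 / 36 else if h = 2 then 1 / 18 else if h = 3 then 17 / 108
    else if h = 20 then 1 / 9 else if h = 22 then 1 / 27 else 0)

namespace LawDec

/-! ### The witness law, its slice and the moved slice -/

/-- `slice ν 2 (1/4)` in closed form. [this work] -/
theorem gmwSlice_eq (h : ℕ) : slice gmwLaw 2 (1 / 4) h = gmwLam h := by
  simp only [slice]
  by_cases h0 : h = 0
  · subst h0; norm_num
  by_cases h1 : h = 1
  · subst h1; norm_num
  by_cases h2 : h = 2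
  · subst h2; norm_num
  by_cases h3 : h = 3
  · subst h3; norm_num
  by_cases h20 : h = 20
  · subst h20; norm_num
  by_cases h22 : h = 22
  · subst h22; norm_num
  have ha : (2 ≤ h) := by omega
  have n0 : h - 2 ≠ 0 := by omega
  have n1 : h - 2 ≠ 1 := by omega
  have n20 : h - 2 ≠ 20 := by omega
  simp [h0, h1, h2, h3, h20, h22, ha, n0, n1, n20]

/-- `ν ≥ 0`. [this work] -/
theorem gmwLaw_nonneg (h : ℕ) : 0 ≤ gmwLaw h := by
  show (0 : ℝ) ≤ (if h = 0 then (2 : ℝ) / 9 else if h = 1 then 17 / 27 else if h = 20 then 4 / 27 else 0)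
  split_ifs <;> norm_num

/-- `ν` vanishes above `20`. [this work] -/
theorem gmwLaw_zero (h : ℕ) (hh : 20 < h) : gmwLaw h = 0 := by
  show (if h = 0 then (2 : ℝ) / 9 else if h = 1 then 17 / 27 else if h = 20 then 4 / 27 else 0) = 0
  rw [if_neg (by omega), if_neg (by omega), if_neg (by omega)]

/-- `ν` has mass `1` on `{0..20}`. [this work] -/
theorem gmwLaw_sum : ∑ h ∈ Finset.range (20 + 1), gmwLaw h = 1 := by
  simp [Finset.sum_range_succ]; norm_num

/-- `ν` has mean `97/27`. [this work] -/
theorem gmwLaw_mean : ∑ h ∈ Finset.range (20 + 1), (h : ℝ) * gmwLaw h = 97 / 27 := by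
  simp [Finset.sum_range_succ]; norm_num

/-- `Λ ≥ 0`, vanishes above `22`, has mass `1` on `{0..22}`. [this work] -/
theorem gmwLam_laws : (∀ h, 0 ≤ gmwLam h) ∧ (∀ h, 20 + 2 < h → gmwLam h = 0) ∧ (∑ h ∈ Finset.range (20 + 2 + 1), gmwLam h = 1) := by
  refine ⟨fun h => ?_, fun h hh => ?_, ?_⟩
  · show (0 : ℝ) ≤ (if h = 0 then (1 : ℝ) / 6 else if h = 1 then 17 / 36 else if h = 2 then 1 / 18 else if h = 3 then 17 / 108
      else if h = 20 then 1 / 9 else if h = 22 then 1 / 27 else 0)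
    split_ifs <;> norm_num
  · show (if h = 0 then (1 : ℝ) / 6 else if h = 1 then 17 / 36 else if h = 2 then 1 / 18 else if h = 3 then 17 / 108
      else if h = 20 then 1 / 9 else if h = 22 then 1 / 27 else 0) = 0
    rw [if_neg (by omega), if_neg (by omega), if_neg (by omega), if_neg (by omega), if_neg (by omega), if_neg (by omega)]
  · simp [Finset.sum_range_succ]; norm_num

/-! ### The usage rates that enter -/

/-- giants of layer `8` at floor `97/540`: usage `97/443`. [this work] -/
theorem usage_gmw_giant (T : ℝ) (l h : ℕ) (hh : 8 + 1 ≤ h) : usage (97 / 540 : ℝ) T 8 l h = 97 / 443 := by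
  rw [usage_giant_eq _ _ _ _ _ hh]; norm_num

/-- `u(2,3) ≤ 1` at target `221/54` (the light pair `2 → 3`; exact value `31559/260041`). [this work] -/
theorem usage_gmw_23_le : usage (97 / 540 : ℝ) (221 / 54) 8 2 3 ≤ 1 := by
  rw [usage_mid_eq (97 / 540 : ℝ) (221 / 54) 8 2 3 (by norm_num) (by norm_num) (by norm_num) (by norm_num) (by norm_num)]
  refine max_le ?_ ?_ <;> norm_num

/-- lower bound of a mid usage by its heavy part: `(T − 2l)/(l + h − T) ≤ usage` (for a compatible mid pair). [this work] -/
theorem heavy_le_usage (x T : ℝ) (j' l h : ℕ) (hx0 : 0 < x) (hx1 : x < 1) (hhj : h ≤ j') (hlow : 2 * (l : ℝ) < T)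
    (hcomp : T < (l : ℝ) + h) : (T - 2 * (l : ℝ)) / ((l : ℝ) + h - T) ≤ usage x T j' l h := by
  rw [usage_mid_eq x T j' l h hx0 hx1 hhj hlow hcomp]; exact le_max_left _ _

/-! ### Hypothesis: `Λ` is DEC -/

/-- **`Λ = slice ν 2 (1/4)` is `DECAtT (97/540) (97/27 + 2·(1/4)) 8 (20 + 2)`** — explicit flow `0 → 22` (`1/6`), `1 → 20` (`17/36`),
`2 → 3` (`1/18`): giant loads `97/2658 ≤ 1/27`, `1649/15948 ≤ 1/9`, mid load `≤ 1/18 ≤ 17/108`. [this work] -/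
theorem gmw_hypLam : DECAtT (97 / 540 : ℝ) (97 / 27 + ((2 : ℕ) : ℝ) * (1 / 4)) 8 (20 + 2) (slice gmwLaw 2 (1 / 4)) := by
  classical
  have eT : (97 / 27 : ℝ) + ((2 : ℕ) : ℝ) * (1 / 4) = 221 / 54 := by norm_num
  rw [eT]
  have hΛ : slice gmwLaw 2 (1 / 4) = gmwLam := funext gmwSlice_eq
  rw [hΛ]
  obtain ⟨l0, lM, l1⟩ := gmwLam_laws
  refine decAtT_of_flowAtT (97 / 540 : ℝ) (221 / 54) 8 (20 + 2) _ (by norm_num) (by norm_num) lM l1 ?_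
  -- the flow
  set f : ℕ → ℕ → ℝ := fun l h =>
    if l = 0 ∧ h = 22 then 1 / 6 else if l = 1 ∧ h = 20 then 17 / 36 else if l = 2 ∧ h = 3 then 1 / 18 else 0 with hf
  have fval : ∀ l h, f l h = (if l = 0 ∧ h = 22 then (1 : ℝ) / 6 else if l = 1 ∧ h = 20 then 17 / 36 else if l = 2 ∧ h = 3 then 1 / 18 else 0) :=
    fun l h => rfl
  refine ⟨f, ?_, ?_, ?_, ?_⟩
  · intro l h; rw [fval]; split_ifs <;> norm_num
  · intro l h hlh
    rw [fval] at hlh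
    split_ifs at hlh with c1 c2 c3
    · obtain ⟨rfl, rfl⟩ := c1; norm_num
    · obtain ⟨rfl, rfl⟩ := c2; norm_num
    · obtain ⟨rfl, rfl⟩ := c3; norm_num
    · exact absurd hlh (lt_irrefl 0)
  · intro l _ hlow
    have hl2 : l ≤ 2 := by
      by_contra hc
      have : (3 : ℝ) ≤ l := by exact_mod_cast (by omega : 3 ≤ l)
      linarith
    interval_cases l
    · rw [Finset.sum_eq_single 22]
      · rw [fval]; simp
      · intro h _ hh; rw [fval]; simp [hh]
      · simp
    · rw [Finset.sum_eq_single 20]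
      · rw [fval]; simp
      · intro h _ hh; rw [fval]; simp [hh]
      · simp
    · rw [Finset.sum_eq_single 3]
      · rw [fval]; norm_num
      · intro h _ hh; rw [fval]; simp [hh]
      · simp
  · intro h hh habs
    by_cases h22 : h = 22
    · subst h22
      rw [Finset.sum_eq_single 0]
      · rw [fval, usage_gmw_giant _ 0 22 (by norm_num)]; norm_num
      · intro l _ hl; rw [fval]; simp [hl]
      · simp
    by_cases h20 : h = 20
    · subst h20
      rw [Finset.sum_eq_single 1]
      · rw [fval, usage_gmw_giant _ 1 20 (by norm_num)]; norm_num
      · intro l _ hl; rw [fval]; simp [hl]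
      · simp
    by_cases h3 : h = 3
    · subst h3
      rw [Finset.sum_eq_single 2]
      · rw [fval]
        have hu := usage_gmw_23_le
        have hu0 : 0 ≤ usage (97 / 540 : ℝ) (221 / 54) 8 2 3 :=
          (usage_pos_of_compat _ _ 8 2 3 (by norm_num) (by norm_num) (by norm_num) (by norm_num) (Or.inr (by norm_num))).le
        norm_num
        nlinarith
      · intro l _ hl; rw [fval]; simp [hl]
      · simp
    · -- no flow into any other column
      have : ∑ l ∈ Finset.range (8 + 1), usage (97 / 540 : ℝ) (221 / 54) 8 l h * f l h = 0 :=
        Finset.sum_eq_zero fun l _ => by rw [fval]; simp [h22, h20, h3]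
      rw [this]; exact l0 h

/-! ### Conclusion: the moved slice is not DEC -/

/-- **the moved slice `Λ + gz(δ₀ − δ₂)` is NOT `DECAtT (97/540) (97/27 + 2·(1/4) − (7/45)·2·(1/4)) 8 (20 + 2)`**: weak duality with
`α₀ = α₁ = 1` and `β_h = 443/97` for `h ≥ 4`. [this work] -/
theorem gmw_not_conclusion :
    ¬ DECAtT (97 / 540 : ℝ) (97 / 27 + ((2 : ℕ) : ℝ) * (1 / 4) - 7 / 45 * ((2 : ℕ) : ℝ) * (1 / 4)) 8 (20 + 2)
      (fun h => slice gmwLaw 2 (1 / 4) h + 1 / 4 * (7 / 45) * ((if h = 0 then (1 : ℝ) else 0) - (if h = 2 then (1 : ℝ) else 0))) := by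
  have eT : (97 / 27 : ℝ) + ((2 : ℕ) : ℝ) * (1 / 4) - 7 / 45 * ((2 : ℕ) : ℝ) * (1 / 4) = 542 / 135 := by norm_num
  rw [eT]
  simp_rw [gmwSlice_eq]
  intro hdec
  have hdual := dual_le_of_decAtT (97 / 540 : ℝ) (542 / 135) 8 (20 + 2) _ (by norm_num) (by norm_num) hdec
    (fun l => if l = 0 ∨ l = 1 then 1 else 0) (fun h => if 4 ≤ h then 443 / 97 else 0)
    (by intro h; split_ifs <;> norm_num) ?_
  · simp only [Finset.sum_range_succ, Finset.sum_range_zero] at hdual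
    norm_num at hdual
  · intro l h hl hlow hh hcomp
    have hβ : (0 : ℝ) ≤ (if 4 ≤ h then 443 / 97 else 0) := by split_ifs <;> norm_num
    by_cases hα : l = 0 ∨ l = 1
    · rw [if_pos hα]
      by_cases hg : 8 + 1 ≤ h
      · rw [usage_gmw_giant _ l h hg, if_pos (by omega)]; norm_num
      · have hc : (542 / 135 : ℝ) < (l : ℝ) + h := hcomp.resolve_left hg
        have hh8 : h ≤ 8 := by omega
        have hl1 : (l : ℝ) ≤ 1 := by rcases hα with rfl | rfl <;> norm_num
        have h4 : 4 ≤ h := by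
          by_contra hc4
          have : (h : ℝ) ≤ 3 := by exact_mod_cast (by omega : h ≤ 3)
          linarith
        rw [if_pos h4]
        have hlowu := heavy_le_usage (97 / 540 : ℝ) (542 / 135) 8 l h (by norm_num) (by norm_num) hh8 hlow hc
        -- `1 ≤ (T − 2l)/(l+h−T) · 443/97` for `l ≤ 1`, `4 ≤ h ≤ 8`
        have hden : 0 < (l : ℝ) + h - 542 / 135 := by linarith
        have hheavy : (97 / 443 : ℝ) ≤ (542 / 135 - 2 * (l : ℝ)) / ((l : ℝ) + h - 542 / 135) := by
          rw [le_div_iff₀ hden]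
          have : (h : ℝ) ≤ 8 := by exact_mod_cast hh8
          nlinarith
        nlinarith
    · rw [if_neg hα]
      have hlh : l < h := by
        rcases hcomp with hg | hc
        · omega
        · have : (l : ℝ) < h := by linarith
          exact_mod_cast this
      exact mul_nonneg (usage_pos_of_compat (97 / 540 : ℝ) (542 / 135) 8 l h (by norm_num) (by norm_num) hlow hlh hcomp).le hβ

/-- **THE MOVE LEMMA (M) WITHOUT THE SUPPORT HYPOTHESIS IS FALSE**: there are `y, z, g, S, a, j, M, ν` satisfying every hypothesis of
`LawDec.decAtT_gateMoveBlob` except `hsupp` — `0 < y < 1`, `0 ≤ z ≤ ν 0`, `g ≤ 1`, `y ≤ (1−z)g`, `1 ≤ a`, `ν` a probability law on `{0..M}` with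
mean `S` and `y·M ≤ S`, `slice ν a g` DEC at `(y, S + ag, j)` — whose moved slice is NOT DEC at `(y, S + ag − zag, j)`.  Witness:
`ν = {0: 2/9, 1: 17/27, 20: 4/27}`, `M = 20`, `a = 2`, `g = 1/4`, `z = 7/45`, `y = 97/540`, `j = 8` (lead g30; README V318). [this work] -/
theorem gateMoveBlob_general_witness :
    ∃ (y z g S : ℝ) (a j M : ℕ) (ν : ℕ → ℝ),
      0 < y ∧ y < 1 ∧ 0 ≤ z ∧ g ≤ 1 ∧ y ≤ (1 - z) * g ∧ 1 ≤ a ∧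
      (∀ h, 0 ≤ ν h) ∧ (∀ h, M < h → ν h = 0) ∧ (∑ h ∈ Finset.range (M + 1), ν h = 1) ∧
      S = ∑ h ∈ Finset.range (M + 1), (h : ℝ) * ν h ∧ y * (M : ℝ) ≤ S ∧ z ≤ ν 0 ∧
      DECAtT y (S + (a : ℝ) * g) j (M + a) (slice ν a g) ∧
      ¬ DECAtT y (S + (a : ℝ) * g - z * (a : ℝ) * g) j (M + a)
        (fun h => slice ν a g h + g * z * ((if h = 0 then (1 : ℝ) else 0) - (if h = a then (1 : ℝ) else 0))) := by
  refine ⟨97 / 540, 7 / 45, 1 / 4, 97 / 27, 2, 8, 20, gmwLaw, by norm_num, by norm_num, by norm_num, by norm_num, by norm_num,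
    by norm_num, gmwLaw_nonneg, gmwLaw_zero, gmwLaw_sum, gmwLaw_mean.symm, by norm_num, by norm_num, gmw_hypLam, ?_⟩
  have e : (fun h : ℕ => slice gmwLaw 2 (1 / 4) h + 1 / 4 * (7 / 45) * ((if h = 0 then (1 : ℝ) else 0) - (if h = 2 then (1 : ℝ) else 0)))
      = (fun h : ℕ => slice gmwLaw 2 (1 / 4) h + 1 / 4 * (7 / 45) * ((if h = 0 then (1 : ℝ) else 0) - (if h = (2 : ℕ) then (1 : ℝ) else 0))) := rfl
  exact gmw_not_conclusion

end LawDec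

end Quant

end Summit.CriticalPhenomena.PercolationContinuityZ3.Theorems
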